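import Summits.Ventures.PercRepro.ProfilePointedCircuitClassesStarNineSplitE

/-!
# PercRepro — THE TWO-PART SPLIT OF THE DEFECT BOUND, PART F: THE CANDIDATE DOUBLE COUNT AND THE KILL BOUND
(p5, gen 58; `proofs/P5-GM1.md` §86 ADD 2)

THE `C`-PAIR CANDIDATES `cands := {π ⊆ X : π + e independent, X − π a basis}` contain the `C`-pairs; the others are the
KILLS (`π + e + f` dependent).  Over the relation `π ⊆ τ` between the first-kind defects and the candidates — no kill
hypothesis needed — every first-kind `τ` has `≥ 2` candidate pairs inside it (`two_le_card_cands_subset`), and a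
candidate `π` lies in at most `5 − cS(π)` first-kind defects, where `cS(π) := #{z ∈ X − π : e ∉ cl(X − π − z)}`
(`card_tTwo_supset_le_five_sub_cS`; `cS(π) + 1` is the size of the fundamental circuit of `e` in `X − π + e`, and
`cS ≥ 3` when `e` lies on no `3`-circuit).  Summing: `2·#tTwo ≤ 2·#cands − #{π : cS = 4} − 2·#{π : cS = 5}`, hence
**`#tTwo ≤ #cPairs` as soon as `2·#kills ≤ #{π ∈ cands : cS π = 4} + 2·#{π ∈ cands : cS π = 5}`** (THE KILL BOUND;
`card_tTwo_le_card_cPairs_of_killBound`), and **`inCount_le_of_killBound`: (★)₉ at `(e, f)`** under the kill bound when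
`e` lies on no `3`-circuit.  Census (kit j337571): the kill bound holds on every core instance with `e` on no
`3`-circuit (854,074 instances with a kill, 0 failures); in the dual, the candidates with `cS = 4` / `5` are the
`C`-pair candidates in the `4`- / `3`-point `f`-planes of `N✶`, the kills are candidates in `5`-point `f`-planes — the
statement that the generic `f`-planes outweigh the degenerate ones, the successor's target for (K).
-/

open scoped Matroid

namespace PercRepro.Cogirth

open Finset ThmH Skew Shadow Profile

open Classical

variable {α : Type} [DecidableEq α] {N : Matroid α} [N.Finite]

section StarNineSplitF

/-- The `C`-PAIR CANDIDATES: the pairs `π ⊆ X` with `π + e` independent and `X − π` a basis. -/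
noncomputable def cands (N : Matroid α) [N.Finite] (e f : α) : Finset (Finset α) :=
  ((((gr N).erase e).erase f).powersetCard 2).filter
    (fun π => rk N (insert e π) = 3 ∧ rk N ((((gr N).erase e).erase f) \ π) = 5)

/-- `cS(π)`: the number of points `z` of `X − π` with `e ∉ cl(X − π − z)` (one less than the size of the fundamental
circuit of `e` in `X − π + e`). -/
noncomputable def cS (N : Matroid α) [N.Finite] (e f : α) (π : Finset α) : ℕ :=
  (((((gr N).erase e).erase f) \ π).filter
    (fun z => rk N (insert e (((((gr N).erase e).erase f) \ π).erase z)) = 5)).card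

/-- Every `C`-pair is a candidate. -/
theorem cPairs_subset_cands (hn : (gr N).card = 9) {e f : α} (he : e ∈ gr N) (hf : f ∈ gr N) (hef : e ≠ f) :
    cPairs N e f ⊆ cands N e f := by
  intro π hπ
  unfold cPairs at hπ
  rw [mem_filter, mem_powersetCard] at hπ
  obtain ⟨⟨hπX, hπ2⟩, hπbi⟩ := hπ
  obtain ⟨_, _, hrk, hcompl⟩ := mem_biIndepSets.1 hπbi
  have heπ : e ∉ π := fun h => (mem_erase.1 (mem_erase.1 (hπX h)).2).1 rfl
  have hfπ : f ∉ π := fun h => (mem_erase.1 (hπX h)).1 rfl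
  have hefπ : e ∉ insert f π := by rw [mem_insert, not_or]; exact ⟨hef, heπ⟩
  rw [gr_sdiff_insert_ef_of_subset_X hπX, card_sdiff_of_subset hπX, card_X hn he hf hef, hπ2] at hcompl
  unfold cands
  rw [mem_filter, mem_powersetCard]
  refine ⟨⟨hπX, hπ2⟩, ?_, by omega⟩
  have := rk_eq_card_of_subset_of_rk_eq_card (M := N)
    (insert_subset_insert e (subset_insert f π) : insert e π ⊆ insert e (insert f π))
    (by rw [hrk])
  rw [this, card_insert_of_notMem heπ, hπ2]

/-- A candidate with `π + e + f` independent is a `C`-pair. -/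
theorem mem_cPairs_of_mem_cands (hn : (gr N).card = 9) {e f : α} (he : e ∈ gr N) (hf : f ∈ gr N) (hef : e ≠ f)
    {π : Finset α} (hπ : π ∈ cands N e f) (hind : rk N (insert e (insert f π)) = 4) : π ∈ cPairs N e f := by
  unfold cands at hπ
  rw [mem_filter, mem_powersetCard] at hπ
  obtain ⟨⟨hπX, hπ2⟩, _, hcompl⟩ := hπ
  have heπ : e ∉ π := fun h => (mem_erase.1 (mem_erase.1 (hπX h)).2).1 rfl
  have hfπ : f ∉ π := fun h => (mem_erase.1 (hπX h)).1 rfl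
  have hefπ : e ∉ insert f π := by rw [mem_insert, not_or]; exact ⟨hef, heπ⟩
  unfold cPairs
  rw [mem_filter, mem_powersetCard, mem_biIndepSets]
  refine ⟨⟨hπX, hπ2⟩, insert_subset he (insert_subset hf (hπX.trans (X_subset_gr N e f))), ?_, ?_, ?_⟩
  · rw [card_insert_of_notMem hefπ, card_insert_of_notMem hfπ, hπ2]
  · rw [hind, card_insert_of_notMem hefπ, card_insert_of_notMem hfπ, hπ2]
  · rw [gr_sdiff_insert_ef_of_subset_X hπX, hcompl, card_sdiff_of_subset hπX, card_X hn he hf hef, hπ2]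

/-- **A FIRST-KIND DEFECT HAS AT LEAST TWO CANDIDATE PAIRS INSIDE IT** (no hypothesis on `f`). -/
theorem two_le_card_cands_subset (hn : (gr N).card = 9)
    (hcos : ∀ x ∈ gr N, ∀ y ∈ gr N, x ≠ y → rk N (((gr N).erase x).erase y) = 5) {e f : α} (he : e ∈ gr N)
    (hf : f ∈ gr N) (hef : e ≠ f) {τ : Finset α} (hτ : τ ∈ tTwo N e f) :
    2 ≤ ((cands N e f).filter (fun π => π ⊆ τ)).card := by
  have hrK := rk_insert_e_sdiff_of_tTwo hn he hf hef hτ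
  have hτ' := hτ
  unfold tTwo at hτ'
  rw [mem_filter] at hτ'
  obtain ⟨hτD, _⟩ := hτ'
  obtain ⟨hτX, hτ3, hrkτe, _, hrkK, hK, _⟩ := edefect_facts hn he hf hef hτD
  set X := ((gr N).erase e).erase f with hXdef
  set K := X \ τ with hKdef
  have hXg : X ⊆ gr N := X_subset_gr N e f
  have hτg : τ ⊆ gr N := hτX.trans hXg
  have hKg : K ⊆ gr N := sdiff_subset.trans hXg
  have heτ : e ∉ τ := fun h => (mem_erase.1 (mem_erase.1 (hτX h)).2).1 rfl
  have heK : e ∉ K := fun h => (mem_erase.1 (mem_erase.1 (mem_sdiff.1 h).1).2).1 rfl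
  set H := clF N K with hHdef
  have hHg : H ⊆ gr N := clF_subset_gr _
  have hH6 : H.card ≤ 6 := card_le_six_of_rk_le_four hn hcos hHg (by rw [rk_clF_eq_rk, hrkK])
  have heH : e ∈ H := by
    rw [hHdef, mem_clF_iff_rk_insert he hKg, hrK, hrkK]
  have hKeH : insert e K ⊆ H := insert_subset heH (subset_clF hKg)
  have hcard5 : (insert e K).card = 5 := by rw [card_insert_of_notMem heK, hK]
  have hτH : τ ∩ H ⊆ H \ insert e K := by
    intro a ha
    rw [mem_inter] at ha
    rw [mem_sdiff, mem_insert, not_or]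
    exact ⟨ha.2, fun h => heτ (h ▸ ha.1), fun h => (mem_sdiff.1 h).2 ha.1⟩
  have hτH1 : (τ ∩ H).card ≤ 1 := by
    have := card_le_card hτH
    rw [card_sdiff_of_subset hKeH, hcard5] at this
    omega
  have hZ : 2 ≤ (τ \ H).card := by
    have := card_sdiff_add_card_inter τ H
    omega
  refine le_trans hZ (card_le_card_of_injOn (fun z => τ.erase z) ?_ ?_)
  · intro z hz
    rw [mem_coe, mem_sdiff] at hz
    rw [mem_coe, mem_filter]
    refine ⟨?_, erase_subset z τ⟩
    have hzg : z ∈ gr N := hτg hz.1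
    have hπX : τ.erase z ⊆ X := (erase_subset _ _).trans hτX
    have hπ2 : (τ.erase z).card = 2 := by rw [card_erase_of_mem hz.1, hτ3]
    have heπ : e ∉ τ.erase z := fun h => heτ (mem_of_mem_erase h)
    have hrkπe : rk N (insert e (τ.erase z)) = 3 := by
      have := rk_eq_card_of_subset_of_rk_eq_card (M := N)
        (insert_subset_insert e (erase_subset z τ) : insert e (τ.erase z) ⊆ insert e τ)
        (by rw [hrkτe, card_insert_of_notMem heτ, hτ3])
      rw [this, card_insert_of_notMem heπ, hπ2]
    have hcompl : rk N (insert z K) = 5 := by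
      rw [rk_insert_of_notMem_clF' hzg hKg hz.2, hrkK]
    unfold cands
    rw [mem_filter, mem_powersetCard]
    refine ⟨⟨hπX, hπ2⟩, hrkπe, ?_⟩
    rw [X_sdiff_erase_eq_insert_sdiff hτX hz.1, hcompl]
  · intro z₁ hz₁ z₂ hz₂ h
    rw [mem_coe, mem_sdiff] at hz₁ hz₂
    exact (erase_inj τ hz₁.1).1 h

/-- **A CANDIDATE LIES IN AT MOST `5 − cS(π)` FIRST-KIND DEFECTS**: a defect `π + z` needs `e ∈ cl(X − π − z)`. -/
theorem card_tTwo_supset_le_five_sub_cS (hn : (gr N).card = 9) {e f : α} (he : e ∈ gr N) (hf : f ∈ gr N)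
    (hef : e ≠ f) {π : Finset α} (hπ : π ∈ cands N e f) :
    ((tTwo N e f).filter (fun τ => π ⊆ τ)).card + cS N e f π ≤ 5 := by
  have hπ' := hπ
  unfold cands at hπ'
  rw [mem_filter, mem_powersetCard] at hπ'
  obtain ⟨⟨hπX, hπ2⟩, _, hBrk⟩ := hπ'
  have hB5 : ((((gr N).erase e).erase f) \ π).card = 5 := by
    rw [card_sdiff_of_subset hπX, card_X hn he hf hef, hπ2]
  unfold cS
  set X := ((gr N).erase e).erase f with hXdef
  set B₀ := X \ π with hB₀
  have hXg : X ⊆ gr N := X_subset_gr N e f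
  have hBg : B₀ ⊆ gr N := sdiff_subset.trans hXg
  -- the partners inject into the complementary filter `{z ∈ B₀ : ρ(e + (B₀ − z)) ≠ 5}`
  have hsub : (tTwo N e f).filter (fun τ => π ⊆ τ) ⊆
      (B₀.filter (fun z => ¬ rk N (insert e (B₀.erase z)) = 5)).image (fun z => insert z π) := by
    intro τ hτ
    rw [mem_filter] at hτ
    obtain ⟨hτT, hπτ⟩ := hτ
    have hrK := rk_insert_e_sdiff_of_tTwo hn he hf hef hτT
    have hτT' := hτT
    unfold tTwo at hτT'
    rw [mem_filter] at hτT'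
    obtain ⟨hτD, _⟩ := hτT'
    obtain ⟨hτX, hτ3, _, _, _, _, _⟩ := edefect_facts hn he hf hef hτD
    have hcard1 : (τ \ π).card = 1 := by rw [card_sdiff_of_subset hπτ, hτ3, hπ2]
    obtain ⟨z, hz⟩ := card_eq_one.1 hcard1
    have hzτπ : z ∈ τ \ π := by rw [hz]; exact mem_singleton_self z
    have hτeq : insert z π = τ := by
      ext a
      rw [mem_insert]
      constructor
      · rintro (rfl | ha)
        · exact (mem_sdiff.1 hzτπ).1
        · exact hπτ ha
      · intro ha
        by_cases haπ : a ∈ π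
        · exact Or.inr haπ
        · left
          have : a ∈ τ \ π := mem_sdiff.2 ⟨ha, haπ⟩
          rw [hz, mem_singleton] at this
          exact this
    have hzB : z ∈ B₀ := mem_sdiff.2 ⟨hτX (mem_sdiff.1 hzτπ).1, (mem_sdiff.1 hzτπ).2⟩
    have hKeq : X \ τ = B₀.erase z := by
      rw [← hτeq, hB₀]
      ext a
      simp only [mem_sdiff, mem_erase, mem_insert, not_or]
      tauto
    rw [mem_image]
    refine ⟨z, ?_, hτeq⟩
    rw [mem_filter]
    refine ⟨hzB, ?_⟩
    rw [← hKeq, hrK]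
    omega
  have h1 : ((tTwo N e f).filter (fun τ => π ⊆ τ)).card ≤
      (B₀.filter (fun z => ¬ rk N (insert e (B₀.erase z)) = 5)).card :=
    (card_le_card hsub).trans card_image_le
  have h2 := card_filter_add_card_filter_not (s := B₀) (fun z => rk N (insert e (B₀.erase z)) = 5)
  rw [hB5] at h2
  omega

/-- **THE CANDIDATE DOUBLE COUNT**: `2·#tTwo + #{π ∈ cands : cS π = 4} + 2·#{π ∈ cands : cS π = 5} ≤ 2·#cands` when `e`
lies on no `3`-circuit (`cS π ≥ 3` for every candidate). -/
theorem two_mul_card_tTwo_add_le (hn : (gr N).card = 9)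
    (hcos : ∀ x ∈ gr N, ∀ y ∈ gr N, x ≠ y → rk N (((gr N).erase x).erase y) = 5) {e f : α} (he : e ∈ gr N)
    (hf : f ∈ gr N) (hef : e ≠ f) (he3 : ∀ A ⊆ gr N, e ∉ A → A.card = 2 → e ∉ clF N A) :
    2 * (tTwo N e f).card + ((cands N e f).filter (fun π => cS N e f π = 4)).card +
      2 * ((cands N e f).filter (fun π => cS N e f π = 5)).card ≤ 2 * (cands N e f).card := by
  have hdc := sum_card_bipartiteAbove_eq_sum_card_bipartiteBelow (fun (τ π : Finset α) => π ⊆ τ)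
    (s := tTwo N e f) (t := cands N e f)
  have hlow : (tTwo N e f).card • 2 ≤
      ∑ τ ∈ tTwo N e f, (bipartiteAbove (fun τ π => π ⊆ τ) (cands N e f) τ).card := by
    apply card_nsmul_le_sum
    intro τ hτ
    unfold bipartiteAbove
    exact two_le_card_cands_subset hn hcos he hf hef hτ
  -- `cS π ≥ 3` for every candidate: at most two `z` have `e ∈ cl(B₀ − z)`
  have hcS3 : ∀ π ∈ cands N e f, 3 ≤ cS N e f π := by
    intro π hπ
    have hπ' := hπ
    unfold cands at hπ'
    rw [mem_filter, mem_powersetCard] at hπ'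
    obtain ⟨⟨hπX, hπ2⟩, _, hBrk⟩ := hπ'
    have hB5 : ((((gr N).erase e).erase f) \ π).card = 5 := by
      rw [card_sdiff_of_subset hπX, card_X hn he hf hef, hπ2]
    have hBg : (((gr N).erase e).erase f) \ π ⊆ gr N := sdiff_subset.trans (X_subset_gr N e f)
    have heB : e ∉ (((gr N).erase e).erase f) \ π :=
      fun h => (mem_erase.1 (mem_erase.1 (mem_sdiff.1 h).1).2).1 rfl
    have h2 := card_filter_mem_clF_erase_le_two_of_five he he3 hBg heB hB5 hBrk
    have h3 := card_filter_add_card_filter_not (s := (((gr N).erase e).erase f) \ π)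
      (fun z => rk N (insert e (((((gr N).erase e).erase f) \ π).erase z)) = 5)
    rw [hB5] at h3
    unfold cS
    -- `¬ (ρ = 5)` is `ρ ≤ 4` for these sets (`ρ ≤ 5`)
    have hcongr : ((((gr N).erase e).erase f) \ π).filter
        (fun z => ¬ rk N (insert e (((((gr N).erase e).erase f) \ π).erase z)) = 5) =
        ((((gr N).erase e).erase f) \ π).filter
        (fun z => rk N (insert e (((((gr N).erase e).erase f) \ π).erase z)) ≤ 4) := by
      apply filter_congr
      intro z hz
      have hle := rk_le_card (M := N) (insert e (((((gr N).erase e).erase f) \ π).erase z))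
      have hc : (insert e (((((gr N).erase e).erase f) \ π).erase z)).card ≤ 5 := by
        rw [card_insert_of_notMem (fun h => heB (mem_of_mem_erase h)), card_erase_of_mem hz, hB5]
      constructor
      · intro h; omega
      · intro h; omega
    rw [hcongr] at h3
    omega
  have hup : ∑ π ∈ cands N e f, (bipartiteBelow (fun τ π => π ⊆ τ) (tTwo N e f) π).card ≤
      ∑ π ∈ cands N e f, (2 - (if cS N e f π = 4 then 1 else 0) - (if cS N e f π = 5 then 2 else 0)) := by
    apply sum_le_sum
    intro π hπ
    rw [show bipartiteBelow (fun τ π => π ⊆ τ) (tTwo N e f) π = (tTwo N e f).filter (fun τ => π ⊆ τ) from rfl]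
    have h5 := card_tTwo_supset_le_five_sub_cS hn he hf hef hπ
    have h3 := hcS3 π hπ
    split_ifs with h4 h5' <;> omega
  rw [hdc] at hlow
  have hsum := hlow.trans hup
  -- evaluate the right-hand sum
  have hrhs : ∑ π ∈ cands N e f, (2 - (if cS N e f π = 4 then 1 else 0) - (if cS N e f π = 5 then 2 else 0)) +
      ((cands N e f).filter (fun π => cS N e f π = 4)).card +
      2 * ((cands N e f).filter (fun π => cS N e f π = 5)).card = 2 * (cands N e f).card := by
    rw [card_filter, card_filter, mul_sum, ← sum_add_distrib, ← sum_add_distrib, card_eq_sum_ones, mul_sum]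
    apply sum_congr rfl
    intro π _
    split_ifs with h4 h5 <;> omega
  simp only [smul_eq_mul] at hsum
  omega

/-- **THE KILL BOUND GIVES THE FIRST-KIND BOUND**: when `e` lies on no `3`-circuit and
`2·#kills ≤ #{π ∈ cands : cS π = 4} + 2·#{π ∈ cands : cS π = 5}` (the kills being the candidates that are not `C`-pairs),
`#tTwo ≤ #cPairs`. -/
theorem card_tTwo_le_card_cPairs_of_killBound (hn : (gr N).card = 9)
    (hcos : ∀ x ∈ gr N, ∀ y ∈ gr N, x ≠ y → rk N (((gr N).erase x).erase y) = 5) {e f : α} (he : e ∈ gr N)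
    (hf : f ∈ gr N) (hef : e ≠ f) (he3 : ∀ A ⊆ gr N, e ∉ A → A.card = 2 → e ∉ clF N A)
    (hkill : 2 * (cands N e f \ cPairs N e f).card ≤
      ((cands N e f).filter (fun π => cS N e f π = 4)).card + 2 * ((cands N e f).filter (fun π => cS N e f π = 5)).card) :
    (tTwo N e f).card ≤ (cPairs N e f).card := by
  have h1 := two_mul_card_tTwo_add_le hn hcos he hf hef he3
  have h2 := card_sdiff_add_card_eq_card (cPairs_subset_cands hn he hf hef (N := N))
  omega

/-- **(★)₉ UNDER THE KILL BOUND**: on a simple cosimple `N` with `#E = 9`, `in_4(e) ≤ in_4(f) + thru_4({e, f})` whenever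
`e` lies on no `3`-circuit and the kill bound holds. -/
theorem inCount_le_of_killBound (hn : (gr N).card = 9)
    (hsimple : ∀ x ∈ gr N, ∀ y ∈ gr N, x ≠ y → rk N {x, y} = 2)
    (hcos : ∀ x ∈ gr N, ∀ y ∈ gr N, x ≠ y → rk N (((gr N).erase x).erase y) = 5) {e f : α} (he : e ∈ gr N)
    (hf : f ∈ gr N) (hef : e ≠ f) (he3 : ∀ A ⊆ gr N, e ∉ A → A.card = 2 → e ∉ clF N A)
    (hkill : 2 * (cands N e f \ cPairs N e f).card ≤
      ((cands N e f).filter (fun π => cS N e f π = 4)).card + 2 * ((cands N e f).filter (fun π => cS N e f π = 5)).card) :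
    inCount N 4 e ≤ inCount N 4 f + thruCount N 4 {e, f} := by
  apply starNine_of_defect_bound hef
  apply defect_bound_of_tTwo_bound hn hsimple hcos he hf hef
  have := card_tTwo_le_card_cPairs_of_killBound hn hcos he hf hef he3 hkill
  omega

end StarNineSplitF

end PercRepro.Cogirth
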